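import Summits.QuantumFields.YangMills.Theorems.UnitScaleTiltProp7QTwSScalarSectorRegPr
import Summits.QuantumFields.YangMills.Theorems.UnitScaleTiltProp7QTwSRealitySectors
import HarnessLib

/-!
# Route `UnitScaleTilt`, crux K1 child «MinimiserStabilityRegPr» (stmt-QuantumFields-19200), stub `stub_existenceMinimalOrbit` (EX), the (R) reality rows of the EX knit —
# **THE THREE `QTwS` SECTOR ROWS OF THE LAYER-0 REALITY ASSEMBLY, UNCONDITIONALLY AT `U₀ ∈ 𝔘_k(ε₀)`**: ★w4-20520 g4's displayed binders `hQ : ∀ A, QTwS U₀ (Aᴴ) = (QTwS U₀ A)ᴴ`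
# (✓`Prop7H46Reality`), `hQsc : ∀ c, ∃ d, QTwS U₀ (c·1) = d·1` and `hQtr` (✓`Prop7H46RealityTrace`), and ym-inputs-p03 g2's `hscR` (✓`Prop7QTwSRealitySectors`) — ALL BY NAME from
# (Q-a) ✓`Prop7QTwSReality.QTwS_skewHermitian_traceless_of_regPr` (★w4-20520 g4) and (Q-b) ✓`QTwS_apply_smul_one_of_regPr` ∕ ✓`QTwS_smul_one_real_of_regPr` (this seat), composed through
# p03 g2's sector algebra ✓`QTwS_star_comm_of_regPr_of_realScalar`.

Cell `ym3-torus`, width seat `ym-ust-20520-w5` (gen 5).  `--supports stmt-QuantumFields-19200 --as helper`; THEOREMS ONLY (0 `def`, 0 `sorry`); count-neutral; nothing here claims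
the stub, the crux, d = 4 or the mass gap — YM₃ on T³ is a ladder rung (R3), not the Clay problem.

WHAT IS PROVED (`U₀ ∈ 𝔘_k(ε₀)`: `RegPr F n K ε₀ U₀`; windows `10⁹L²e ≤ 1`, `10¹²L³ε₀ ≤ 1` of (Q-a)).
* ★★★`QTwS_star_comm_of_regPr … (hε₀ he hWe hWε) (U₀) (hreg) : ∀ A, QTwS F n K h U₀ (star A) = star (QTwS F n K h U₀ A)` — ★w4-20520 g4's `hQ` VERBATIM.
* ★★`QTwS_scalar_of_regPr (hε₀ hWε) (U₀) (hreg) : ∀ c, ∃ d, QTwS F n K h U₀ (fun b => c b • 1) = fun c' => d c' • 1` — `hQsc` VERBATIM (witness the flat average; no `e` window).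
* ★`QTwS_traceless_of_regPr … : ∀ A, (∀ b, tr (A b) = 0) → ∀ c, tr (QTwS F n K h U₀ A c) = 0` — `hQtr` VERBATIM (= ✓`trace_QTwS_eq_zero_of_regPr`, re-exported in the binder's shape).
* `QTwS_sectors_of_regPr` — the three rows bundled.
HONEST SCOPE.  Three-line compositions of landed theorems; nothing of [Balaban1985Variational]∕[Balaban1985BackgroundPropagators] is asserted; the remaining displayed data row of the (R-H)
assembly is `hΔtr` (the traceless sector of `Δ^η`, ★w4-20520 g4's claim) — not touched here.

References: T. Bałaban, CMP **102** (1985) 277–309 [Balaban1985Variational] ((51) p.286); CMP **99** (1985) 389–434 [Balaban1985BackgroundPropagators] ((3.13)–(3.14) p.393);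
CMP **95** (1984) 17–40 [Balaban1984PropagatorsI] ((1.18) p.20).
-/

set_option autoImplicit false

noncomputable section

open scoped Matrix.Norms.L2Operator

namespace Summit.QuantumFields.YangMills.Theorems.Prop7SymAvgTwSym

open Literature.MathematicalPhysics.QuantumFieldTheory.Balaban1983to89
open T3ContinuumYM3Torus LatticeFieldCalculus
open T3LevelShift (bondShift)
open T3PrintedRegularOrbits (sites_eq)
open T3PrintedRegularMinimiser (RegPr)
open Summit.QuantumFields.YangMills.Theorems.Prop7QTwSRealitySectors (QTwS_star_comm_of_regPr_of_realScalar trace_QTwS_eq_zero_of_regPr)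

variable (F : T3Family) {n K : ℕ} (h : n ≤ K)

/-- ★★★ **`hQ` — `QTwS U₀ (Aᴴ) = (QTwS U₀ A)ᴴ` FOR EVERY FINE FIELD `A`, UNCONDITIONALLY AT `U₀ ∈ 𝔘_k(ε₀)`** (windows `10⁹L²e ≤ 1`, `10¹²L³ε₀ ≤ 1`): (Q-a) ✓`QTwS_skewHermitian_traceless_of_regPr`
and (Q-b)ʳ ✓`QTwS_smul_one_real_of_regPr` through p03 g2's ✓`QTwS_star_comm_of_regPr_of_realScalar`. [cite: Balaban1985Variational, (51) p.286; Balaban1985BackgroundPropagators, (3.13)-(3.14) p.393] -/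
theorem QTwS_star_comm_of_regPr [Fact (0 < (F.L : ℝ))] [Fact (0 < ((F.L : ℝ)⁻¹) ^ (K - n))]
    {ε₀ e : ℝ} (hε₀ : 0 < ε₀) (he : 0 < e) (hWe : 10 ^ 9 * (F.L : ℝ) ^ 2 * e ≤ 1) (hWε : 10 ^ 12 * (F.L : ℝ) ^ 3 * ε₀ ≤ 1)
    (U₀ : GaugeField (F.P K) 0 (Matrix.specialUnitaryGroup (Fin 2) ℂ)) (hreg : RegPr F n K ε₀ U₀) :
    ∀ A : PBond (F.P K) 0 → Matrix (Fin 2) (Fin 2) ℂ, QTwS F n K h U₀ (star A) = star (QTwS F n K h U₀ A) :=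
  fun A => QTwS_star_comm_of_regPr_of_realScalar F h hε₀ he hWe hWε U₀ hreg (QTwS_smul_one_real_of_regPr F h hε₀ hWε U₀ hreg) A

/-- ★★ **`hQsc` — `QTwS U₀` MAPS EVERY COMPLEX SCALAR FIELD TO A SCALAR FIELD** at `U₀ ∈ 𝔘_k(ε₀)` (`10¹²L³ε₀ ≤ 1`; witness the flat average of ✓`QTwS_apply_smul_one_of_regPr`).
[cite: Balaban1985Variational, (51) p.286; Balaban1984PropagatorsI, (1.18) p.20] -/
theorem QTwS_scalar_of_regPr {ε₀ : ℝ} (hε₀ : 0 < ε₀) (hWε : 10 ^ 12 * (F.L : ℝ) ^ 3 * ε₀ ≤ 1)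
    (U₀ : GaugeField (F.P K) 0 (Matrix.specialUnitaryGroup (Fin 2) ℂ)) (hreg : RegPr F n K ε₀ U₀) :
    ∀ c : PBond (F.P K) 0 → ℂ, ∃ d : PBond (F.P n) 0 → ℂ,
      QTwS F n K h U₀ (fun b => c b • (1 : Matrix (Fin 2) (Fin 2) ℂ)) = fun c' => d c' • 1 :=
  fun c => ⟨fun c' => (((F.P K).L : ℂ)) ^ (K - n) * bondAvgIter (K - n) c (bondShift (sites_eq F n K h) c'), QTwS_apply_smul_one_of_regPr F h hε₀ hWε U₀ hreg c⟩

/-- ★ **`hQtr` — `QTwS U₀` MAPS TRACELESS FINE FIELDS TO TRACELESS BLOCK FIELDS** at `U₀ ∈ 𝔘_k(ε₀)` ((Q-a) alone; p03 g2's ✓`trace_QTwS_eq_zero_of_regPr` in the binder's shape).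
[cite: Balaban1985Variational, (51) p.286; Balaban1985BackgroundPropagators, (3.14) p.393] -/
theorem QTwS_traceless_of_regPr [Fact (0 < (F.L : ℝ))] [Fact (0 < ((F.L : ℝ)⁻¹) ^ (K - n))]
    {ε₀ e : ℝ} (hε₀ : 0 < ε₀) (he : 0 < e) (hWe : 10 ^ 9 * (F.L : ℝ) ^ 2 * e ≤ 1) (hWε : 10 ^ 12 * (F.L : ℝ) ^ 3 * ε₀ ≤ 1)
    (U₀ : GaugeField (F.P K) 0 (Matrix.specialUnitaryGroup (Fin 2) ℂ)) (hreg : RegPr F n K ε₀ U₀) :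
    ∀ A : PBond (F.P K) 0 → Matrix (Fin 2) (Fin 2) ℂ, (∀ b, (A b).trace = 0) → ∀ c, (QTwS F n K h U₀ A c).trace = 0 :=
  fun A hA c => trace_QTwS_eq_zero_of_regPr F h hε₀ he hWe hWε U₀ hreg A hA c

/-- **THE THREE `QTwS` ROWS OF THE LAYER-0 REALITY ASSEMBLY, BUNDLED** (`hQ ∧ hQsc ∧ hQtr` at `U₀ ∈ 𝔘_k(ε₀)`). [cite: Balaban1985Variational, (51) p.286; Balaban1985BackgroundPropagators, (3.13)-(3.14) p.393] -/
theorem QTwS_sectors_of_regPr [Fact (0 < (F.L : ℝ))] [Fact (0 < ((F.L : ℝ)⁻¹) ^ (K - n))]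
    {ε₀ e : ℝ} (hε₀ : 0 < ε₀) (he : 0 < e) (hWe : 10 ^ 9 * (F.L : ℝ) ^ 2 * e ≤ 1) (hWε : 10 ^ 12 * (F.L : ℝ) ^ 3 * ε₀ ≤ 1)
    (U₀ : GaugeField (F.P K) 0 (Matrix.specialUnitaryGroup (Fin 2) ℂ)) (hreg : RegPr F n K ε₀ U₀) :
    (∀ A : PBond (F.P K) 0 → Matrix (Fin 2) (Fin 2) ℂ, QTwS F n K h U₀ (star A) = star (QTwS F n K h U₀ A)) ∧
    (∀ c : PBond (F.P K) 0 → ℂ, ∃ d : PBond (F.P n) 0 → ℂ, QTwS F n K h U₀ (fun b => c b • (1 : Matrix (Fin 2) (Fin 2) ℂ)) = fun c' => d c' • 1) ∧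
    (∀ A : PBond (F.P K) 0 → Matrix (Fin 2) (Fin 2) ℂ, (∀ b, (A b).trace = 0) → ∀ c, (QTwS F n K h U₀ A c).trace = 0) :=
  ⟨QTwS_star_comm_of_regPr F h hε₀ he hWe hWε U₀ hreg, QTwS_scalar_of_regPr F h hε₀ hWε U₀ hreg, QTwS_traceless_of_regPr F h hε₀ he hWe hWε U₀ hreg⟩

end Summit.QuantumFields.YangMills.Theorems.Prop7SymAvgTwSym

end
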